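import Summits.MatrixMultiplication.OmegaCensus.STPPCell22Sound3
import Summits.MatrixMultiplication.OmegaCensus.STPPCell22Sound4

/-!
# ω-census (abelian STPP census): cell-(2,2) certificate soundness, part 5 — masks representing finsets of `ZMod p` (tool file)

HONEST FRAMING (pub-omega census; verbatim): lottery ticket; floor = certified bounds/negative ranges.
Census STRUCTURE (seat pub-omega-stpp-1 gen 33, 2026-08-29), family (b2).  Bridges between `Finset (ZMod p)` and the kernel masks of
`STPPCell22Checker.lean` (plan HOME `pub-omega-stpp-1-g33/FIFTH-LEAF.md` §SOUNDNESS, step S6): a mask `m` REPRESENTS `X` when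
`tb m v ↔ ∃ x ∈ X, x.val = v`; the value-list mask represents `X` (`tb_valMask`), representation is unique below `2^p` (`eq_of_rep`), and it is carried
by translation to `rot` (`rep_rot`), by dilation to `dilMask` (`rep_dilMask`), by `{0,1,y} + ·` to `s1Mask` (`rep_s1Mask`); `members` lists the values
(`mem_members_of_rep`).  UNCONDITIONAL; no `decide`.  Nothing here is progress on `ω`.

References: H. S. Warren, Hacker's Delight (2002), §2-1 (bit sets); H. Cohn, R. Kleinberg, B. Szegedy, C. Umans, FOCS 2005, Def. 5.1 (the use).
-/

namespace Summit.MatrixMultiplication.OmegaCensus.CubeNB.S2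

open Finset Summit.MatrixMultiplication.OmegaCensus.CubeNB.Bits
open scoped Pointwise

variable {p : ℕ} [hp : Fact p.Prime]

/-- **The value-list mask represents the finset.** [folklore] -/
theorem tb_valMask (X : Finset (ZMod p)) (v : ℕ) : tb (maskOf ((X.image ZMod.val).sort (· ≤ ·))) v = true ↔ ∃ x ∈ X, x.val = v := by
  rw [tb_maskOf, (valList_spec X).1]

/-- The value-list mask is below `2^p`. [folklore] -/
theorem valMask_lt_two_pow (X : Finset (ZMod p)) : maskOf ((X.image ZMod.val).sort (· ≤ ·)) < 2 ^ p :=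
  maskOf_lt_two_pow (valList_spec X).2.2.1

/-- A representing mask is below `2^p`. [folklore] -/
theorem lt_two_pow_of_rep {X : Finset (ZMod p)} {m : ℕ} (hm : ∀ v, tb m v = true ↔ ∃ x ∈ X, x.val = v) : m < 2 ^ p := by
  refine Nat.lt_pow_two_of_testBit _ fun i hi => ?_
  rw [← tb_eq_testBit, Bool.eq_false_iff]
  intro h
  obtain ⟨x, _, hx⟩ := (hm i).1 h
  have := x.val_lt; omega

/-- **Representation is unique.** [folklore] -/
theorem eq_of_rep {X : Finset (ZMod p)} {m n : ℕ} (hm : ∀ v, tb m v = true ↔ ∃ x ∈ X, x.val = v) (hn : ∀ v, tb n v = true ↔ ∃ x ∈ X, x.val = v) :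
    m = n :=
  eq_of_tb_eq (lt_two_pow_of_rep hm) (lt_two_pow_of_rep hn) fun i _ => by rw [Bool.eq_iff_iff, hm, hn]

/-- **`members` of a representing mask** lists exactly the values of `X`, without duplicates. [folklore] -/
theorem mem_members_of_rep {X : Finset (ZMod p)} {m : ℕ} (hm : ∀ v, tb m v = true ↔ ∃ x ∈ X, x.val = v) :
    (∀ v, v ∈ members (List.range p) m ↔ ∃ x ∈ X, x.val = v) ∧ (members (List.range p) m).Nodup := by
  refine ⟨fun v => ?_, nodup_members (List.nodup_range (n := p)) m⟩
  rw [mem_members, List.mem_range, hm]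
  constructor
  · exact fun h => h.2
  · rintro ⟨x, hx, rfl⟩; exact ⟨x.val_lt, x, hx, rfl⟩

/-- **Translation is `rot`.** [folklore] -/
theorem rep_rot {X : Finset (ZMod p)} {m : ℕ} (hm : ∀ v, tb m v = true ↔ ∃ x ∈ X, x.val = v) (t : ZMod p) :
    ∀ v, tb (rot p m t.val) v = true ↔ ∃ x ∈ X.image (· + t), x.val = v := by
  have hp0 : 0 < p := hp.out.pos
  have hmlt := lt_two_pow_of_rep hm
  intro v
  rcases Nat.lt_or_ge v p with hv | hv
  · rw [tb_rot hmlt t.val_lt.le hv, hm]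
    constructor
    · rintro ⟨x, hx, hxv⟩
      refine ⟨x + t, mem_image.2 ⟨x, hx, rfl⟩, ?_⟩
      rw [ZMod.val_add, hxv, mod_sub_add_cancel hv t.val_lt.le]
    · rintro ⟨e, he, rfl⟩
      obtain ⟨x, hx, rfl⟩ := mem_image.1 he
      exact ⟨x, hx, by rw [ZMod.val_add, mod_add_sub_cancel x.val_lt t.val_lt.le]⟩
  · rw [tb_eq_false_of_lt (rot_lt_two_pow _ _ _) hv]
    constructor
    · intro h; exact absurd h (by decide)
    · rintro ⟨x, _, rfl⟩; exact absurd x.val_lt (not_lt.2 hv)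

/-- **Dilation is `dilMask`.** [folklore] -/
theorem rep_dilMask {X : Finset (ZMod p)} {m : ℕ} (hm : ∀ v, tb m v = true ↔ ∃ x ∈ X, x.val = v) (w : ZMod p) :
    ∀ v, tb (dilMask p m w.val) v = true ↔ ∃ x ∈ X.image (w * ·), x.val = v := by
  intro v
  rw [tb_dilMask]
  constructor
  · rintro ⟨x, _, hx, rfl⟩
    obtain ⟨e, he, rfl⟩ := (hm x).1 hx
    exact ⟨w * e, mem_image.2 ⟨e, he, rfl⟩, by rw [ZMod.val_mul, Nat.mul_comm]⟩
  · rintro ⟨x, hx, rfl⟩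
    obtain ⟨e, he, rfl⟩ := mem_image.1 hx
    exact ⟨e.val, e.val_lt, (hm _).2 ⟨e, he, rfl⟩, by rw [ZMod.val_mul, Nat.mul_comm]⟩

/-- **`{0, 1, y} + X` is `s1Mask`** (for `p > 1`). [folklore] -/
theorem rep_s1Mask {X : Finset (ZMod p)} {m : ℕ} (hm : ∀ v, tb m v = true ↔ ∃ x ∈ X, x.val = v) (y : ZMod p) :
    ∀ v, tb (s1Mask p y.val m) v = true ↔ ∃ e ∈ ({0, 1, y} : Finset (ZMod p)) + X, e.val = v := by
  have h1 : (1 : ZMod p).val = 1 := ZMod.val_one'' (hp.out.one_lt.ne')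
  have hr1 := rep_rot hm 1
  have hry := rep_rot hm y
  rw [h1] at hr1
  intro v
  rw [s1Mask, tb_lor, tb_lor, Bool.or_eq_true, Bool.or_eq_true, hm, hr1, hry]
  have h0m : (0 : ZMod p) ∈ ({0, 1, y} : Finset (ZMod p)) := by simp
  have h1m : (1 : ZMod p) ∈ ({0, 1, y} : Finset (ZMod p)) := by simp
  have hym : y ∈ ({0, 1, y} : Finset (ZMod p)) := by simp
  constructor
  · rintro ((⟨x, hx, rfl⟩ | ⟨x, hx, rfl⟩) | ⟨x, hx, rfl⟩)
    · exact ⟨0 + x, mem_add.2 ⟨0, h0m, x, hx, rfl⟩, by rw [zero_add]⟩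
    · obtain ⟨e, he, rfl⟩ := mem_image.1 hx
      exact ⟨1 + e, mem_add.2 ⟨1, h1m, e, he, rfl⟩, by rw [add_comm]⟩
    · obtain ⟨e, he, rfl⟩ := mem_image.1 hx
      exact ⟨y + e, mem_add.2 ⟨y, hym, e, he, rfl⟩, by rw [add_comm]⟩
  · rintro ⟨e, he, rfl⟩
    obtain ⟨a, ha, x, hx, rfl⟩ := mem_add.1 he
    simp only [mem_insert, mem_singleton] at ha
    rcases ha with rfl | rfl | ha3
    · left; left; exact ⟨x, hx, by rw [zero_add]⟩
    · left; right; exact ⟨x + 1, mem_image.2 ⟨x, hx, rfl⟩, by rw [add_comm]⟩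
    · right; rw [ha3]; exact ⟨x + y, mem_image.2 ⟨x, hx, rfl⟩, by rw [add_comm]⟩

end Summit.MatrixMultiplication.OmegaCensus.CubeNB.S2
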